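import Summits.HodgeConjecture.HodgeConjecture.Theorems.EightfoldBlochSeedsBlochSeedsGenericCarrierShapeTests
import Literature.AlgebraicGeometry.HodgeTheory.WeilTypePeriodPoint
import Literature.AlgebraicGeometry.HodgeTheory.KaehlerClass
import Literature.AlgebraicGeometry.Hyperkaehler.BeauvilleBogomolovForm
import Literature.AlgebraicGeometry.Motives.HyperbolicWeilTypeProduct
import HarnessLib

/-!
# Route `EightfoldBlochSeeds`, cruxes `BlochSeedsGeneric` (item stmt-HodgeConjecture-18880) / `BlochSeedDiscThree` (18882), line
# `pad4-cm-anchor`, stubs `stub_pad4_carrier` / `stub_rung_pad4_seedAt`: THE POWERS OF THE STUBS' CLASS `h_K` DO NOT VANISH —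
# `h_Kᵖ ≠ 0` for `1 ≤ p ≤ dim A`, every `d ≥ 1`, every abelian variety `A` with an endomorphism `φ`, every embedding `e` and rational
# `a ≠ 0` — so the carrier coordinates `(q, w)` of `q·h_Kⁿ + w` are UNCONDITIONALLY unique and `q` is read by one cup product

HONEST FRAMING. Nothing here proves either stub, either crux, rung H2, HC_AV or the Hodge conjecture; nothing is constructed.
UNCONDITIONAL `--supports` lemmas (no named fact as hypothesis, no definition, no Literature fact; D-0026). Census-neutral.

WHAT IS HERE (leafhand `leafhand-hodge-eightfoldblochseed-1-g1`). The two coordinate theorems of this hand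
(`carrierCoords_unique`, `carrierClass_q_eq_zero_iff`, files `…CarrierCoordinates` / `…CarrierShapeTests`) carried the hypotheses
`h_Kⁿ ≠ 0`, `h_K^{2n} ≠ 0`. They are DISCHARGED here for the stubs' class `h_K = d·e^*a + φ^*e^*a` from tree theorems: `h_K` is a
non-zero real multiple of a Kähler class (`exists_isKaehlerClass_ksymm_eq_smul`: restricted Fubini–Study metric, symmetrised), the
powers `Hᵖ`, `1 ≤ p ≤ dim`, of a Kähler class on a smooth projective variety are non-zero (`IsKaehlerClass.cupPowTwo_ne_zero`, Voisin I
Cor. 3.9 on the summit carrier), and `(s·H)ᵖ = sᵖ·Hᵖ` (`Hyperkaehler.cupPowTwo_smul`):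

* `cupPowTwo_ksymm_ne_zero` — `cupPowTwo h_K p ≠ 0` for `1 ≤ p ≤ dim A` (any abelian variety `A` of positive dimension, any `φ`,
  `d ≥ 1`, any projective embedding `e`, rational `a ≠ 0`).
* `carrierCoords_unique_ksymm'` — on an abelian `2n`-fold with `φ ≫ φ = -d` (`n, d ≥ 1`): `q·h_Kⁿ + w = q'·h_Kⁿ + w'` with `w, w'` in
  the Weil plane forces `q = q'` AND `w = w'` — no hypothesis left.
* `carrierClass_q_eq_zero_iff_ksymm` — `q = 0 ↔ h_Kⁿ ⌣ (q·h_Kⁿ + w) = 0` — no hypothesis left.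

So for every `d` and every CM datum, the pair `(q, w)` that `stub_pad4_carrier` / `stub_rung_pad4_seedAt` attach to a carrier is a
FUNCTION of the supported class, and its `ℚ[h_K]`-part is decided by the single number-valued cup product `h_K⁴ ⌣ x ∈ ℂ·h_K⁸`,
`h_K⁸ ≠ 0`.

## References

[cite: VoisinHodgeI2002, §3.1.3 Cor. 3.9, §3.3.2 and §7.1.2] [cite: vanGeemen1994HodgeAV, Lemma 5.2 (1) and proof of Thm. 6.12]
[cite: HatcherAT2002, §3.2]
-/

noncomputable section

-- single-problem summit (Problem = Summit): the mandated namespace repeats `HodgeConjecture`.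
set_option linter.dupNamespace false

open CategoryTheory AlgebraicGeometry
open Literature.AlgebraicGeometry Literature.AlgebraicGeometry.Motives Literature.AlgebraicGeometry.HodgeTheory
open Literature.AlgebraicTopology.SingularHomology

namespace Summit.HodgeConjecture.HodgeConjecture.Theorems

variable {A : AbelianVariety ℂ} {d : ℕ}

/-- **`h_Kᵖ ≠ 0` for `1 ≤ p ≤ dim A`.** For an abelian variety `A` of dimension `m + 1`, any endomorphism `φ`, `d ≥ 1`, any
projective embedding `e` and any rational `a ≠ 0` on the ambient projective space, the `K`-symmetrised class
`h_K = d·e^*a + φ^*e^*a` has `cupPowTwo h_K p ≠ 0` for `1 ≤ p ≤ m + 1`: `h_K = s·H'` with `s ∈ ℝˣ` and `H'` Kähler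
(`exists_isKaehlerClass_ksymm_eq_smul`), `h_Kᵖ = sᵖ·H'ᵖ` (`cupPowTwo_smul`) and `H'ᵖ ≠ 0` (`IsKaehlerClass.cupPowTwo_ne_zero`).
[cite: VoisinHodgeI2002, §3.1.3 Cor. 3.9 and §3.3.2] -/
theorem cupPowTwo_ksymm_ne_zero {m : ℕ} (hA : A.dim = m + 1) (hd : 0 < d) (φ : A ⟶ A) (e : ProjectiveEmbedding A.X)
    {a : complexBetti (projectiveSpace e.n ℂ) 2} (ha : IsRationalClass a) (ha0 : a ≠ 0) {p : ℕ} (hp1 : 1 ≤ p)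
    (hp : p ≤ m + 1) :
    cupPowTwo ((d : ℂ) • complexBetti.map e.ι 2 a + complexBetti.map φ.hom.hom.hom 2 (complexBetti.map e.ι 2 a)) p ≠ 0 := by
  obtain ⟨s, H', hs, hK, hh⟩ := exists_isKaehlerClass_ksymm_eq_smul hA hd φ e ha ha0
  have hX : IsSmoothProjective (m + 1) A.X := Motives.isSmoothProjective_of_dim_eq' hA
  rw [hh, Literature.AlgebraicGeometry.Hyperkaehler.cupPowTwo_smul]
  exact smul_ne_zero (pow_ne_zero _ (by exact_mod_cast hs)) (hK.cupPowTwo_ne_zero hX hp1 hp)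

variable {φ : A ⟶ A} {n : ℕ}

/-- **The carrier coordinates are unconditionally unique.** On an abelian `2n`-fold `A` with `φ ≫ φ = -d` (`n, d ≥ 1`), for the
`K`-symmetrised class `h_K = d·e^*a + φ^*e^*a` of any projective embedding `e` and rational `a ≠ 0`, rational `q, q'` and `w, w'` in
the Weil plane: `q·h_Kⁿ + w = q'·h_Kⁿ + w'` forces `q = q'` and `w = w'` (`carrierCoords_unique_ksymm` with `h_Kⁿ ≠ 0` discharged by
`cupPowTwo_ksymm_ne_zero`, `n ≤ 2n`). [cite: vanGeemen1994HodgeAV, Lemma 5.2 (1) and proof of Thm. 6.12] [cite: VoisinHodgeI2002, §3.1.3 Cor. 3.9] -/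
theorem carrierCoords_unique_ksymm' (hA : A.dim = 2 * n) (hn : 0 < n) (hd : 0 < d) (hφ : φ ≫ φ = -(d • 𝟙 A))
    (e : ProjectiveEmbedding A.X) {a : complexBetti (projectiveSpace e.n ℂ) 2} (ha : IsRationalClass a) (ha0 : a ≠ 0)
    {q q' : ℚ} {w w' : complexBetti A.X (2 * n)} (hw : w ∈ weilClassesOf A φ n d) (hw' : w' ∈ weilClassesOf A φ n d)
    (heq : ((q : ℚ) : ℂ) •
          cupPowTwo ((d : ℂ) • complexBetti.map e.ι 2 a + complexBetti.map φ.hom.hom.hom 2 (complexBetti.map e.ι 2 a)) n + w =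
        ((q' : ℚ) : ℂ) •
          cupPowTwo ((d : ℂ) • complexBetti.map e.ι 2 a + complexBetti.map φ.hom.hom.hom 2 (complexBetti.map e.ι 2 a)) n + w') :
    q = q' ∧ w = w' := by
  obtain ⟨m, hm⟩ : ∃ m, 2 * n = m + 1 := ⟨2 * n - 1, by omega⟩
  have hne := cupPowTwo_ksymm_ne_zero (hm ▸ hA) hd φ e ha ha0 (p := n) hn (by omega)
  obtain ⟨hww, hq⟩ := carrierCoords_unique_ksymm hd hφ hn (complexBetti.map e.ι 2 a) hw hw' heq
  exact ⟨hq hne, hww⟩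

/-- **`q` is read by one cup product, unconditionally**: under the same hypotheses, for a complex `q` and `w` in the Weil plane,
`q = 0 ↔ h_Kⁿ ⌣ (q·h_Kⁿ + w) = 0` (`carrierClass_q_eq_zero_iff` with `h_K^{2n} ≠ 0` discharged, `2n = dim A`; `h_K` is
`K`-symmetric by `map_ksymm_eq_smul`). For a carrier `Z` with `cl(Z) = q·h_Kⁿ + w`: `q = 0` iff `deg_{h_K} Z = 0`.
[cite: vanGeemen1994HodgeAV, proof of Thm. 6.12] [cite: VoisinHodgeI2002, §3.1.3 Cor. 3.9] -/
theorem carrierClass_q_eq_zero_iff_ksymm (hA : A.dim = 2 * n) (hn : 0 < n) (hd : 0 < d) (hφ : φ ≫ φ = -(d • 𝟙 A))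
    (e : ProjectiveEmbedding A.X) {a : complexBetti (projectiveSpace e.n ℂ) 2} (ha : IsRationalClass a) (ha0 : a ≠ 0)
    {w : complexBetti A.X (2 * n)} (hw : w ∈ weilClassesOf A φ n d) (q : ℂ) (hs : 2 * n + 2 * n = 2 * (2 * n)) :
    q = 0 ↔
      cupProduct hs (cupPowTwo ((d : ℂ) • complexBetti.map e.ι 2 a + complexBetti.map φ.hom.hom.hom 2 (complexBetti.map e.ι 2 a)) n)
        (q • cupPowTwo ((d : ℂ) • complexBetti.map e.ι 2 a + complexBetti.map φ.hom.hom.hom 2 (complexBetti.map e.ι 2 a)) n + w)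
        = 0 := by
  obtain ⟨m, hm⟩ : ∃ m, 2 * n = m + 1 := ⟨2 * n - 1, by omega⟩
  have h2n := cupPowTwo_ksymm_ne_zero (hm ▸ hA) hd φ e ha ha0 (p := 2 * n) (by omega) (by omega)
  exact carrierClass_q_eq_zero_iff hA hn hd hφ (map_ksymm_eq_smul hφ _) h2n hw q hs

end Summit.HodgeConjecture.HodgeConjecture.Theorems

end
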